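import Mathlib.Tactic.Linarith
import Summits.CriticalPhenomena.PercolationContinuityZ3.Theorems.PercNearOneGluingNoHeavyLowerTailSahiCTCNewtonBlocks
import Summits.CriticalPhenomena.PercolationContinuityZ3.Theorems.PercNearOneGluingNoHeavyLowerTailSahiCTCVertexAtoms
import HarnessLib

/-!
# `NoHeavyLowerTail` (crux stmt-CriticalPhenomena-4575), P3 lane: small CUBE COUNTING LEMMAS on a ground set `G`
# (`e₁·e₁ ≥ 2e₂`, `e₁·Π_G ≥ e₁ + 2·D₂` coefficientwise) — infrastructure for the single-common-edge case of the ladder form `L₂`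

Support file (seat `prim-l12-p3`, gen 24; `--supports stmt-CriticalPhenomena-4575`).  Memo `run/shared/lean/prim/prim-l12/FROM-prim-l12-p3-g24-VALUE-
LEVEL-TH2K.md` §5.8 (Lean blueprint, lemmas (L1), (L3)).  With `E1 = GF{S ⊆ G : #S = 1}`, `E2 = GF{S ⊆ G : #S = 2}`, `P = GF(2^G)`, `D2 = GF{S ⊆ G : 2 ≤ #S}`:
* `coeff_two_mul_pairs_le_singles_sq` : (L3) `2·E2 ≤ E1·E1` coefficientwise (both orders of a pair);
* `coeff_two_mul_atLeastTwo_le` : (L2) `2·D2 ≤ E2·P + 2·E2` (a 2-set pays itself twice; a bigger set contains two distinct pairs);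
* `coeff_atLeastTwo_mul_le` : (L4) `D2·(1 + E1) ≤ E2·(P + E1)` (2-subsets `(Q, T∖Q)`, `C(t,2) ≥ t+1` for `t ≥ 4`, the three pairs `(T∖w,{w})` at `t = 3`);
* `coeff_singles_add_two_mul_le` : (L1) `E1 + 2·D2 ≤ E1·P` coefficientwise (a singleton is `{w} ∪ ∅`; a set with two distinct elements `a, b` is
  `{a} ∪ (T∖a)` and `{b} ∪ (T∖b)`).
Nothing is asserted about the crux.
-/

namespace Summit.CriticalPhenomena.PercolationContinuityZ3.Theorems.SahiCTCForms

open Finset MvPolynomial SahiCTCGenFun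

variable {α : Type*} [DecidableEq α]

omit [DecidableEq α] in
/-- `1_{{a}} = single a 1`. [this work] -/
theorem ind_singleton_eq_single (a : α) : ind ({a} : Finset α) = Finsupp.single a 1 := by
  unfold ind; rw [sum_singleton]

/-- If no member of `F` has profile `n` then `coeff_n GF(F) = 0`; if exactly the member `T` has it then `coeff_n GF(F) = 1`. [this work] -/
theorem coeff_gf_of_mem {F : Finset (Finset α)} {T : Finset α} (hT : T ∈ F) : (gf F).coeff (ind T) = 1 := by
  rw [coeff_gf]
  have : F.filter (fun S => ind S = ind T) = {T} := by
    ext S; simp only [mem_filter, mem_singleton]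
    exact ⟨fun h => ind_injective h.2, fun h => by subst h; exact ⟨hT, rfl⟩⟩
  rw [this, card_singleton]; rfl

/-- `coeff_n GF(F) ≤ 1` always, and `= 0` unless `n = 1_T` for some `T ∈ F`. [this work] -/
theorem coeff_gf_eq_zero_of_forall {F : Finset (Finset α)} {n : α →₀ ℕ} (h : ∀ T ∈ F, ind T ≠ n) : (gf F).coeff n = 0 := by
  rw [coeff_gf]
  have : F.filter (fun S => ind S = n) = ∅ := filter_eq_empty_iff.2 fun S hS hn => h S hS hn
  rw [this, card_empty]; rfl

/-- **(L3)** `2·GF{#S = 2} ≤ GF{#S = 1}·GF{#S = 1}` coefficientwise on any ground set `G`. [this work] -/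
theorem coeff_two_mul_pairs_le_singles_sq (G : Finset α) (n : α →₀ ℕ) :
    (2 * gf (G.powerset.filter fun S => #S = 2)).coeff n ≤
      (gf (G.powerset.filter fun S => #S = 1) * gf (G.powerset.filter fun S => #S = 1)).coeff n := by
  rw [show (2 : MvPolynomial α ℤ) = C 2 from by simp, coeff_C_mul, coeff_gf_mul_gf]
  by_cases h : ∃ T ∈ G.powerset.filter (fun S => #S = 2), ind T = n
  · obtain ⟨T, hT, rfl⟩ := h
    rw [coeff_gf_of_mem hT, mul_one]
    obtain ⟨hTG, hT2⟩ := mem_filter.1 hT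
    obtain ⟨a, b, hab, rfl⟩ := card_eq_two.1 hT2
    have haG : a ∈ G := mem_powerset.1 hTG (by simp)
    have hbG : b ∈ G := mem_powerset.1 hTG (by simp)
    have h1 : ∀ x ∈ G, ({x} : Finset α) ∈ G.powerset.filter (fun S => #S = 1) := fun x hx =>
      mem_filter.2 ⟨mem_powerset.2 (singleton_subset_iff.2 hx), card_singleton x⟩
    have hsum : ind ({a} : Finset α) + ind ({b} : Finset α) = ind ({a, b} : Finset α) := by
      rw [show ({a, b} : Finset α) = insert a {b} from rfl, ind_insert (by simpa using hab), ind_singleton_eq_single]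
    have hsub : ({(({a} : Finset α), ({b} : Finset α)), (({b} : Finset α), ({a} : Finset α))} : Finset (Finset α × Finset α)) ⊆
        ((G.powerset.filter fun S => #S = 1) ×ˢ (G.powerset.filter fun S => #S = 1)).filter
          (fun PS => ind PS.1 + ind PS.2 = ind ({a, b} : Finset α)) := by
      intro PS hPS
      rcases mem_insert.1 hPS with rfl | hPS
      · exact mem_filter.2 ⟨mem_product.2 ⟨h1 a haG, h1 b hbG⟩, hsum⟩
      · rw [mem_singleton] at hPS; subst hPS
        exact mem_filter.2 ⟨mem_product.2 ⟨h1 b hbG, h1 a haG⟩, by rw [add_comm]; exact hsum⟩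
    have hcard : #({(({a} : Finset α), ({b} : Finset α)), (({b} : Finset α), ({a} : Finset α))} : Finset (Finset α × Finset α)) = 2 := by
      rw [card_insert_of_notMem, card_singleton]
      rw [mem_singleton]; intro h
      exact hab (singleton_injective (Prod.ext_iff.1 h).1)
    have := card_le_card hsub
    rw [hcard] at this
    exact_mod_cast this
  · have h0 : (gf (G.powerset.filter fun S => #S = 2)).coeff n = 0 :=
      coeff_gf_eq_zero_of_forall fun T hT hn => h ⟨T, hT, hn⟩
    rw [h0, mul_zero]
    exact_mod_cast Nat.zero_le _

/-- **(L1)** `GF{#S = 1} + 2·GF{2 ≤ #S} ≤ GF{#S = 1}·GF(2^G)` coefficientwise on any ground set `G`. [this work] -/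
theorem coeff_singles_add_two_mul_le (G : Finset α) (n : α →₀ ℕ) :
    (gf (G.powerset.filter fun S => #S = 1) + 2 * gf (G.powerset.filter fun S => 2 ≤ #S)).coeff n ≤
      (gf (G.powerset.filter fun S => #S = 1) * gf G.powerset).coeff n := by
  rw [coeff_add, show (2 : MvPolynomial α ℤ) = C 2 from by simp, coeff_C_mul, coeff_gf_mul_gf]
  have h1 : ∀ x ∈ G, ({x} : Finset α) ∈ G.powerset.filter (fun S => #S = 1) := fun x hx =>
    mem_filter.2 ⟨mem_powerset.2 (singleton_subset_iff.2 hx), card_singleton x⟩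
  by_cases hs : ∃ T ∈ G.powerset.filter (fun S => #S = 1), ind T = n
  · -- n = 1_{w}: the pair ({w}, ∅)
    obtain ⟨T, hT, rfl⟩ := hs
    obtain ⟨hTG, hT1⟩ := mem_filter.1 hT
    obtain ⟨w, rfl⟩ := card_eq_one.1 hT1
    rw [coeff_gf_of_mem hT, coeff_gf_eq_zero_of_forall, mul_zero, add_zero]
    · have hmem : ((({w} : Finset α)), (∅ : Finset α)) ∈ ((G.powerset.filter fun S => #S = 1) ×ˢ G.powerset).filter
          (fun PS => ind PS.1 + ind PS.2 = ind ({w} : Finset α)) := by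
        refine mem_filter.2 ⟨mem_product.2 ⟨hT, mem_powerset.2 (empty_subset _)⟩, ?_⟩
        show ind {w} + ind ∅ = ind {w}
        unfold ind; rw [sum_empty, add_zero]
      exact_mod_cast card_pos.2 ⟨_, hmem⟩
    · intro S hS hSw
      have := ind_injective hSw
      subst this
      have := (mem_filter.1 hS).2; rw [card_singleton] at this; omega
  by_cases hb : ∃ T ∈ G.powerset.filter (fun S => 2 ≤ #S), ind T = n
  · -- n = 1_T with #T ≥ 2: the pairs ({a}, T∖a), ({b}, T∖b)
    obtain ⟨T, hT, rfl⟩ := hb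
    obtain ⟨hTG, hT2⟩ := mem_filter.1 hT
    rw [coeff_gf_eq_zero_of_forall (fun S hS hST => hs ⟨S, hS, hST⟩), coeff_gf_of_mem hT, zero_add, mul_one]
    obtain ⟨a, haT, b, hbT, hab⟩ := one_lt_card.1 (by omega : 1 < #T)
    have hTG' := mem_powerset.1 hTG
    have hmemx : ∀ x ∈ T, ((({x} : Finset α)), T.erase x) ∈ ((G.powerset.filter fun S => #S = 1) ×ˢ G.powerset).filter
        (fun PS => ind PS.1 + ind PS.2 = ind T) := fun x hx =>
      mem_filter.2 ⟨mem_product.2 ⟨h1 x (hTG' hx), mem_powerset.2 ((erase_subset x T).trans hTG')⟩,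
        ind_singleton_add_ind_erase hx⟩
    have hsub : ({((({a} : Finset α)), T.erase a), ((({b} : Finset α)), T.erase b)} : Finset (Finset α × Finset α)) ⊆
        ((G.powerset.filter fun S => #S = 1) ×ˢ G.powerset).filter (fun PS => ind PS.1 + ind PS.2 = ind T) := by
      intro PS hPS
      rcases mem_insert.1 hPS with rfl | hPS
      · exact hmemx a haT
      · rw [mem_singleton] at hPS; subst hPS; exact hmemx b hbT
    have hcard : #({((({a} : Finset α)), T.erase a), ((({b} : Finset α)), T.erase b)} : Finset (Finset α × Finset α)) = 2 := by
      rw [card_insert_of_notMem, card_singleton]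
      rw [mem_singleton]; intro h
      exact hab (singleton_injective (Prod.ext_iff.1 h).1)
    have := card_le_card hsub
    rw [hcard] at this
    exact_mod_cast this
  · rw [coeff_gf_eq_zero_of_forall (fun S hS hST => hs ⟨S, hS, hST⟩),
      coeff_gf_eq_zero_of_forall (fun S hS hST => hb ⟨S, hS, hST⟩), mul_zero, add_zero]
    exact_mod_cast Nat.zero_le _

/-- **(L2)** `2·GF{2 ≤ #S} ≤ GF{#S = 2}·(GF(2^G) + 2)` coefficientwise on any ground set `G`. [this work] -/
theorem coeff_two_mul_atLeastTwo_le (G : Finset α) (n : α →₀ ℕ) :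
    (2 * gf (G.powerset.filter fun S => 2 ≤ #S)).coeff n ≤
      (gf (G.powerset.filter fun S => #S = 2) * gf G.powerset + 2 * gf (G.powerset.filter fun S => #S = 2)).coeff n := by
  rw [coeff_add, show (2 : MvPolynomial α ℤ) = C 2 from by simp, coeff_C_mul, coeff_C_mul, coeff_gf_mul_gf]
  by_cases hb : ∃ T ∈ G.powerset.filter (fun S => 2 ≤ #S), ind T = n
  · obtain ⟨T, hT, rfl⟩ := hb
    obtain ⟨hTG, hT2⟩ := mem_filter.1 hT
    have hTG' := mem_powerset.1 hTG
    rw [coeff_gf_of_mem hT, mul_one]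
    by_cases h2 : #T = 2
    · -- a 2-set: `2·E2` alone pays
      have hT' : T ∈ G.powerset.filter (fun S => #S = 2) := mem_filter.2 ⟨hTG, h2⟩
      rw [coeff_gf_of_mem hT', mul_one]
      have : (0 : ℤ) ≤ #(((G.powerset.filter fun S => #S = 2) ×ˢ G.powerset).filter fun PS => ind PS.1 + ind PS.2 = ind T) := by
        exact_mod_cast Nat.zero_le _
      linarith
    · -- `#T ≥ 3`: two distinct pairs inside `T`
      have h3 : 3 ≤ #T := by omega
      obtain ⟨a, haT, b, hbT, hab⟩ := one_lt_card.1 (by omega : 1 < #T)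
      have hc : 0 < #((T.erase a).erase b) := by
        rw [card_erase_of_mem (mem_erase.2 ⟨hab.symm, hbT⟩), card_erase_of_mem haT]; omega
      obtain ⟨c, hc⟩ := card_pos.1 hc
      have hcb : c ≠ b := (mem_erase.1 hc).1
      have hca : c ≠ a := (mem_erase.1 (mem_erase.1 hc).2).1
      have hcT : c ∈ T := (mem_erase.1 (mem_erase.1 hc).2).2
      -- the pairs ({a,b}, T∖{a,b}) and ({a,c}, T∖{a,c})
      have hpair : ∀ x y, x ∈ T → y ∈ T → x ≠ y →
          ((({x, y} : Finset α)), (T.erase x).erase y) ∈ ((G.powerset.filter fun S => #S = 2) ×ˢ G.powerset).filter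
            (fun PS => ind PS.1 + ind PS.2 = ind T) := by
        intro x y hx hy hxy
        refine mem_filter.2 ⟨mem_product.2 ⟨mem_filter.2 ⟨mem_powerset.2 ?_, card_pair hxy⟩,
          mem_powerset.2 (((erase_subset _ _).trans (erase_subset _ _)).trans hTG')⟩, ?_⟩
        · intro z hz; rcases mem_insert.1 hz with rfl | hz
          · exact hTG' hx
          · rw [mem_singleton] at hz; subst hz; exact hTG' hy
        · show ind {x, y} + ind ((T.erase x).erase y) = ind T
          rw [show ({x, y} : Finset α) = insert x {y} from rfl, ind_insert (by simpa using hxy), add_assoc,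
            ind_singleton_add_ind_erase (mem_erase.2 ⟨hxy.symm, hy⟩), ← ind_singleton_eq_single, ind_singleton_add_ind_erase hx]
      have hsub : ({((({a, b} : Finset α)), (T.erase a).erase b), ((({a, c} : Finset α)), (T.erase a).erase c)} :
          Finset (Finset α × Finset α)) ⊆ ((G.powerset.filter fun S => #S = 2) ×ˢ G.powerset).filter
            (fun PS => ind PS.1 + ind PS.2 = ind T) := by
        intro PS hPS
        rcases mem_insert.1 hPS with rfl | hPS
        · exact hpair a b haT hbT hab
        · rw [mem_singleton] at hPS; subst hPS; exact hpair a c haT hcT hca.symm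
      have hcard : #({((({a, b} : Finset α)), (T.erase a).erase b), ((({a, c} : Finset α)), (T.erase a).erase c)} :
          Finset (Finset α × Finset α)) = 2 := by
        rw [card_insert_of_notMem, card_singleton]
        rw [mem_singleton]; intro h
        have h1 : ({a, b} : Finset α) = {a, c} := (Prod.ext_iff.1 h).1
        have : b ∈ ({a, c} : Finset α) := by rw [← h1]; simp
        rcases mem_insert.1 this with h' | h'
        · exact hab h'.symm
        · rw [mem_singleton] at h'; exact hcb h'.symm
      have hle := card_le_card hsub
      rw [hcard] at hle
      have h0 : (0 : ℤ) ≤ (gf (G.powerset.filter fun S => #S = 2)).coeff (ind T) := coeff_gf_nonneg _ _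
      have hle' : (2 : ℤ) ≤ #(((G.powerset.filter fun S => #S = 2) ×ˢ G.powerset).filter fun PS => ind PS.1 + ind PS.2 = ind T) := by
        exact_mod_cast hle
      linarith
  · rw [coeff_gf_eq_zero_of_forall (fun S hS hST => hb ⟨S, hS, hST⟩), mul_zero]
    have h0 : (0 : ℤ) ≤ (gf (G.powerset.filter fun S => #S = 2)).coeff n := coeff_gf_nonneg _ _
    have h1 : (0 : ℤ) ≤ #(((G.powerset.filter fun S => #S = 2) ×ˢ G.powerset).filter fun PS => ind PS.1 + ind PS.2 = n) := by
      exact_mod_cast Nat.zero_le _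
    linarith

/-- The pairs `(Q, T ∖ Q)`, `Q` a 2-subset of `T ⊆ G`, are distinct witnesses of the profile `1_T` in `GF{#S = 2}·GF(2^G)`; hence that coefficient is at
least `C(#T, 2)`. [this work] -/
theorem choose_two_le_coeff_pairs_mul (G : Finset α) {T : Finset α} (hTG : T ⊆ G) :
    ((#T).choose 2 : ℤ) ≤ (gf (G.powerset.filter fun S => #S = 2) * gf G.powerset).coeff (ind T) := by
  rw [coeff_gf_mul_gf, ← card_powersetCard 2 T]
  refine Nat.cast_le.2 (card_le_card_of_injOn (fun Q => (Q, T \ Q)) (fun Q hQ => ?_) (fun Q _ Q' _ h => (Prod.ext_iff.1 h).1))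
  obtain ⟨hQT, hQ2⟩ := mem_powersetCard.1 (Finset.mem_coe.1 hQ)
  rw [Finset.mem_coe, mem_filter]
  refine ⟨mem_product.2 ⟨mem_filter.2 ⟨mem_powerset.2 (hQT.trans hTG), hQ2⟩, mem_powerset.2 (sdiff_subset.trans hTG)⟩, ?_⟩
  show ind Q + ind (T \ Q) = ind T
  rw [ind_add_ind_eq_iff]
  refine ⟨fun i => by rw [ind_apply]; split; all_goals omega, ?_, union_sdiff_of_subset hQT ▸ ?_⟩
  · ext i; simp only [mem_inter, mem_sdiff, dbl, mem_filter, Finsupp.mem_support_iff, ind_apply]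
    constructor
    · rintro ⟨h1, _, h2⟩; exact absurd h1 h2
    · rintro ⟨_, h⟩; split_ifs at h; all_goals omega
  · ext i; simp only [Finsupp.mem_support_iff, ind_apply]; split_ifs <;> simp_all

/-- **(L4)** `GF{2 ≤ #S}·(1 + GF{#S = 1}) ≤ GF{#S = 2}·(GF(2^G) + GF{#S = 1})` coefficientwise on any ground set `G`. [this work] -/
theorem coeff_atLeastTwo_mul_le (G : Finset α) (n : α →₀ ℕ) :
    (gf (G.powerset.filter fun S => 2 ≤ #S) * (1 + gf (G.powerset.filter fun S => #S = 1))).coeff n ≤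
      (gf (G.powerset.filter fun S => #S = 2) * (gf G.powerset + gf (G.powerset.filter fun S => #S = 1))).coeff n := by
  set F1 := G.powerset.filter fun S => #S = 1 with hF1
  set F2 := G.powerset.filter fun S => #S = 2 with hF2
  set D2 := G.powerset.filter fun S => 2 ≤ #S with hD2
  have h1mem : ∀ x ∈ G, ({x} : Finset α) ∈ F1 := fun x hx =>
    mem_filter.2 ⟨mem_powerset.2 (singleton_subset_iff.2 hx), card_singleton x⟩
  have nonneg1 : (0 : ℤ) ≤ (gf F2 * gf G.powerset).coeff n := coeff_mul_nonneg (coeff_gf_nonneg _) (coeff_gf_nonneg _) _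
  have nonneg2 : (0 : ℤ) ≤ (gf F2 * gf F1).coeff n := coeff_mul_nonneg (coeff_gf_nonneg _) (coeff_gf_nonneg _) _
  rw [mul_add, mul_one, mul_add, coeff_add, coeff_add, coeff_gf_mul_gf D2 F1 n]
  by_cases hn : ∀ i, n i ≤ 2
  swap
  · rw [filter_prod_eq_empty _ _ n hn, card_empty]
    have : (gf D2).coeff n = 0 := by
      refine coeff_gf_eq_zero_of_forall fun T _ hT => hn fun i => ?_
      rw [← hT, ind_apply]; split_ifs; all_goals omega
    rw [this]; push_cast; linarith
  by_cases hsq : dbl n = ∅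
  · -- squarefree profile: n = 1_T with T = supp n
    obtain ⟨T, hT⟩ : ∃ T : Finset α, T = n.support := ⟨_, rfl⟩
    have hnT : n = ind T := by
      ext i; rw [ind_apply, hT]
      by_cases hi : i ∈ n.support
      · rw [if_pos hi]
        have h2 := hn i
        have h0 := Finsupp.mem_support_iff.1 hi
        have : i ∉ dbl n := by rw [hsq]; exact notMem_empty i
        rw [dbl, mem_filter] at this
        have h3 : n i ≠ 2 := fun h => this ⟨hi, h⟩
        omega
      · rw [if_neg hi]; exact Finsupp.notMem_support_iff.1 hi
    subst hnT
    -- the E1·D2 pairs are ((T.erase w), {w}), w ∈ T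
    have hpairs_sub : ((D2 ×ˢ F1).filter fun PS => ind PS.1 + ind PS.2 = ind T) ⊆ T.image fun w => (T.erase w, {w}) := by
      intro PS hPS
      obtain ⟨hmem, hsum⟩ := mem_filter.1 hPS
      obtain ⟨hS, hW⟩ := mem_product.1 hmem
      obtain ⟨w, hw⟩ := card_eq_one.1 (mem_filter.1 hW).2
      obtain ⟨_, hI, hU⟩ := (ind_add_ind_eq_iff _ _ _).1 hsum
      rw [hsq] at hI
      have hU' : PS.1 ∪ PS.2 = T := by rw [hU]; ext i; simp [Finsupp.mem_support_iff, ind_apply]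
      have hwT : w ∈ T := by rw [← hU', hw]; exact mem_union_right _ (mem_singleton_self w)
      have hwS : w ∉ PS.1 := fun h => by
        have : w ∈ PS.1 ∩ PS.2 := mem_inter.2 ⟨h, by rw [hw]; exact mem_singleton_self w⟩
        rw [hI] at this; exact notMem_empty w this
      refine mem_image.2 ⟨w, hwT, Prod.ext ?_ hw.symm⟩
      show T.erase w = PS.1
      rw [← hU', hw]; ext i; simp only [mem_erase, mem_union, mem_singleton]
      constructor
      · rintro ⟨h1, h2 | h2⟩
        · exact h2
        · exact absurd h2 h1
      · intro h; exact ⟨fun h' => hwS (h' ▸ h), Or.inl h⟩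
    have hE1D2_le : (#((D2 ×ˢ F1).filter fun PS => ind PS.1 + ind PS.2 = ind T) : ℤ) ≤ #T := by
      exact_mod_cast (card_le_card hpairs_sub).trans card_image_le
    by_cases hTG : T ⊆ G
    swap
    · have hD : (gf D2).coeff (ind T) = 0 := coeff_gf_eq_zero_of_forall fun S hS hST => hTG (by
        rw [← ind_injective hST]; exact mem_powerset.1 (mem_filter.1 hS).1)
      have hE : ((D2 ×ˢ F1).filter fun PS => ind PS.1 + ind PS.2 = ind T) = ∅ := by
        refine filter_eq_empty_iff.2 fun PS hPS hsum => hTG ?_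
        obtain ⟨hS, hW⟩ := mem_product.1 hPS
        obtain ⟨_, _, hU⟩ := (ind_add_ind_eq_iff _ _ _).1 hsum
        have hU' : PS.1 ∪ PS.2 = T := by rw [hU]; ext i; simp [Finsupp.mem_support_iff, ind_apply]
        rw [← hU']; exact union_subset (mem_powerset.1 (mem_filter.1 hS).1) (mem_powerset.1 (mem_filter.1 hW).1)
      rw [hD, hE, card_empty]; push_cast; linarith
    rcases Nat.lt_or_ge #T 2 with hT1 | hT2
    · have hD : (gf D2).coeff (ind T) = 0 := coeff_gf_eq_zero_of_forall fun S hS hST => by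
        have := (mem_filter.1 hS).2; rw [ind_injective hST] at this; omega
      have hE : ((D2 ×ˢ F1).filter fun PS => ind PS.1 + ind PS.2 = ind T) = ∅ := by
        refine filter_eq_empty_iff.2 fun PS hPS hsum => ?_
        have hPS' : PS ∈ (D2 ×ˢ F1).filter (fun PS => ind PS.1 + ind PS.2 = ind T) := mem_filter.2 ⟨hPS, hsum⟩
        obtain ⟨w, hwT, hw⟩ := mem_image.1 (hpairs_sub hPS')
        have hS2 := (mem_filter.1 (mem_product.1 hPS).1).2
        rw [← hw] at hS2; simp only at hS2
        have := card_erase_lt_of_mem hwT; omega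
      rw [hD, hE, card_empty]; push_cast; linarith
    have hD : (gf D2).coeff (ind T) = 1 := coeff_gf_of_mem (mem_filter.2 ⟨mem_powerset.2 hTG, hT2⟩)
    have hC := choose_two_le_coeff_pairs_mul G hTG
    rw [← hF2] at hC
    rcases Nat.lt_or_ge #T 4 with hT3 | hT4
    · rcases (by omega : #T = 2 ∨ #T = 3) with hTc | hTc
      · -- #T = 2: no E1·D2 pair (the rest would have size 1); the pair (T, ∅) on the right
        have hE : ((D2 ×ˢ F1).filter fun PS => ind PS.1 + ind PS.2 = ind T) = ∅ := by
          refine filter_eq_empty_iff.2 fun PS hPS hsum => ?_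
          have hPS' : PS ∈ (D2 ×ˢ F1).filter (fun PS => ind PS.1 + ind PS.2 = ind T) := mem_filter.2 ⟨hPS, hsum⟩
          obtain ⟨w, hwT, hw⟩ := mem_image.1 (hpairs_sub hPS')
          have hS2 := (mem_filter.1 (mem_product.1 hPS).1).2
          rw [← hw] at hS2; simp only at hS2
          rw [card_erase_of_mem hwT] at hS2; omega
        rw [hD, hE, card_empty]
        rw [hTc] at hC; norm_num at hC ⊢; linarith
      · -- #T = 3: three E2·E1 pairs (T.erase w, {w})
        have hsub3 : T.image (fun w => (T.erase w, ({w} : Finset α))) ⊆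
            (F2 ×ˢ F1).filter (fun PS => ind PS.1 + ind PS.2 = ind T) := by
          intro PS hPS
          obtain ⟨w, hwT, rfl⟩ := mem_image.1 hPS
          refine mem_filter.2 ⟨mem_product.2 ⟨mem_filter.2 ⟨mem_powerset.2 ((erase_subset w T).trans hTG), ?_⟩, h1mem w (hTG hwT)⟩, ?_⟩
          · rw [card_erase_of_mem hwT, hTc]
          · show ind (T.erase w) + ind {w} = ind T
            rw [add_comm]; exact ind_singleton_add_ind_erase hwT
        have hinj : Set.InjOn (fun w => (T.erase w, ({w} : Finset α))) T := fun w _ w' _ h =>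
          singleton_injective (Prod.ext_iff.1 h).2
        have h3 : (3 : ℤ) ≤ (gf F2 * gf F1).coeff (ind T) := by
          rw [coeff_gf_mul_gf]
          have := card_le_card hsub3
          rw [card_image_of_injOn hinj, hTc] at this
          exact_mod_cast this
        have hE1D2_le' : (#((D2 ×ˢ F1).filter fun PS => ind PS.1 + ind PS.2 = ind T) : ℤ) ≤ 3 := by
          rw [hTc] at hE1D2_le; exact_mod_cast hE1D2_le
        rw [hD]; rw [hTc] at hC; norm_num at hC ⊢; linarith
    · -- #T ≥ 4: C(#T,2) ≥ #T + 1
      have hchoose : (#T : ℤ) + 1 ≤ ((#T).choose 2 : ℤ) := by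
        have : #T + 1 ≤ (#T).choose 2 := by
          rw [Nat.choose_two_right, Nat.le_div_iff_mul_le (by norm_num)]
          obtain ⟨m, hm⟩ : ∃ m, #T = m + 4 := ⟨#T - 4, by omega⟩
          rw [hm, show m + 4 - 1 = m + 3 from by omega]; nlinarith
        exact_mod_cast this
      rw [hD]; linarith
  · -- a doubled point x
    obtain ⟨x, hx⟩ : (dbl n).Nonempty := nonempty_iff_ne_empty.2 hsq
    have hD : (gf D2).coeff n = 0 := coeff_gf_eq_zero_of_forall fun S _ hS => by
      have := (mem_filter.1 hx).2; rw [← hS, ind_apply] at this; split_ifs at this; all_goals omega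
    rw [hD]
    have hx2 : n x = 2 := (mem_filter.1 hx).2
    have hpairs_sub : ((D2 ×ˢ F1).filter fun PS => ind PS.1 + ind PS.2 = n) ⊆ {(n.support, ({x} : Finset α))} := by
      intro PS hPS
      obtain ⟨hmem, hsum⟩ := mem_filter.1 hPS
      obtain ⟨hS, hW⟩ := mem_product.1 hmem
      obtain ⟨w, hw⟩ := card_eq_one.1 (mem_filter.1 hW).2
      obtain ⟨_, hI, hU⟩ := (ind_add_ind_eq_iff _ _ _).1 hsum
      have hxI : x ∈ PS.1 ∩ PS.2 := by rw [hI]; exact hx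
      have hwx : w = x := by
        have := (mem_inter.1 hxI).2; rw [hw, mem_singleton] at this; exact this.symm
      subst hwx
      rw [mem_singleton]
      refine Prod.ext ?_ hw
      show PS.1 = n.support
      rw [← hU, hw]; exact (union_eq_left.2 (singleton_subset_iff.2 (mem_inter.1 hxI).1)).symm
    have hle1 : (#((D2 ×ˢ F1).filter fun PS => ind PS.1 + ind PS.2 = n) : ℤ) ≤ 1 := by
      exact_mod_cast (card_le_card hpairs_sub).trans (card_singleton _).le
    by_cases hP : ((D2 ×ˢ F1).filter fun PS => ind PS.1 + ind PS.2 = n).Nonempty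
    · obtain ⟨PS, hPS⟩ := hP
      have hPS' := hpairs_sub hPS
      rw [mem_singleton] at hPS'; subst hPS'
      obtain ⟨hmem, hsum⟩ := mem_filter.1 hPS
      obtain ⟨hS, hW⟩ := mem_product.1 hmem
      have hSG : n.support ⊆ G := mem_powerset.1 (mem_filter.1 hS).1
      have hS2 : 2 ≤ #n.support := (mem_filter.1 hS).2
      have hxS : x ∈ n.support := Finsupp.mem_support_iff.2 (by omega)
      obtain ⟨y, hyS, hyx⟩ : ∃ y ∈ n.support, y ≠ x := by
        have : 0 < #(n.support.erase x) := by rw [card_erase_of_mem hxS]; omega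
        obtain ⟨y, hy⟩ := card_pos.1 this
        exact ⟨y, (mem_erase.1 hy).2, (mem_erase.1 hy).1⟩
      have hwit : ((({x, y} : Finset α)), n.support.erase y) ∈ (F2 ×ˢ G.powerset).filter (fun PS => ind PS.1 + ind PS.2 = n) := by
        refine mem_filter.2 ⟨mem_product.2 ⟨mem_filter.2 ⟨mem_powerset.2 ?_, card_pair hyx.symm⟩,
          mem_powerset.2 ((erase_subset _ _).trans hSG)⟩, ?_⟩
        · intro z hz; rcases mem_insert.1 hz with rfl | hz
          · exact hSG hxS
          · rw [mem_singleton] at hz; subst hz; exact hSG hyS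
        · show ind {x, y} + ind (n.support.erase y) = n
          rw [show ({x, y} : Finset α) = insert x {y} from rfl, ind_insert (by simpa using hyx.symm), add_assoc,
            ind_singleton_add_ind_erase hyS, ← ind_singleton_eq_single, add_comm]
          exact hsum
      have h1 : (1 : ℤ) ≤ (gf F2 * gf G.powerset).coeff n := by
        rw [coeff_gf_mul_gf]; exact_mod_cast card_pos.2 ⟨_, hwit⟩
      linarith
    · rw [not_nonempty_iff_eq_empty.1 hP, card_empty]; push_cast; linarith

end Summit.CriticalPhenomena.PercolationContinuityZ3.Theorems.SahiCTCForms
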